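import Mathlib
import Summits.ResolutionOfSingularities.ResolutionOfSingularities.Theorems.WeightedInvariantLocalWeightedDropWildMonicWClean

/-!
# `WeightedInvariant.LocalWeightedDrop`, line `hasse-ridge-face-selection`, S3ρ sub-stub S3ρD₂ `stub_wildMonicSurfaceDescent₂`:
# CASE D-d (KANGAROO) — definitions for Perlega's modified Moh bound (Prop. 6.2.3) on monic tuples

Crux item stmt-ResolutionOfSingularities-8899 `LocalWeightedDrop` (route `ResolutionOfSingularities/WeightedInvariant`), engine of the
door `HypersurfaceCentreConstruction` stmt-ResolutionOfSingularities-19897.  [OURS · L1 W4.3, chain w43, seat res-type-056 on ROADMAP item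
(C8) = D-d KANGAROO of `L/res-L1-w43-stub-7/S3RHOD-ROADMAP.md` (named by the roadmap owner res-D-pv-005 AS res-L1-w43-stub-7); objects the
engine line posits for the MEASURE of the general monic surface game.  MODEL: S. Perlega, *A new proof for the embedded resolution of surface
singularities in arbitrary characteristic*, thesis Wien 2017 / arXiv:2011.14443 [cite: Perlega2020, Ch. 2 §2 (weighted order functions,
initial forms, weak initial ideals, Lemma 2.2.1 «`ỹ(f) = (w₁(f), w₂(in_{w₁}(f)))`»), Ch. 6 §2.1 (Lemma 6.2.1, Prop. 6.2.3 «`d_* =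
ord_{(y₁)} minit_w(J̃₂)`», Prop. 6.2.4 «`d(I) = ord I − ord_{(x)} I − ord_{(y)} I`»)] = Hauser–Perlega, Publ. RIMS 60 (2024) Lemma 2
(`in_ω(F) = x^a y^b·H`, `d^curv_𝓕`).  Nothing here is a statement of H. Hironaka's manuscript [claim: Hironaka2017, status: under-review];
nothing is asserted about Perlega's text — these are OUR definitions, read on the coefficient tuple `A = (A_j)_{j<d}` of the monic form
`y^d + Σ_j A_j y^j` (a POSITION of res-type-083's `WildMonic.monic_won_of_descent₂`) in the strategy's own coordinates.]

THE SITUATION.  Two letters `x ≠ y` of `Fin 2` (Perlega's `(x, y)`; for the kangaroo flags of Prop. 9.1.4 case (4) the consumer takes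
`y = 0` = the exceptional letter of the chart and `x = 1`, for the tangent flags of Prop. 7.4.8 `y = 1`), a weight `w` with `w x = 1`,
`w y = n ≥ 1`, and the TWISTED letter `y₁ = y + t·xⁿ` (`t ≠ 0`): the flag curve `V(y_d, y₁)` is tangent of order `n` to `V(y_d, y)`.  Perlega's
numbers for such a flag live in the coordinates `(x, y₁)` SUBORDINATE to it; a series `F(x, y)` is moved there by the substitution
`y ↦ y₁ − t·xⁿ` (`twist`), after which «`ord_{(y₁)}`» is the plain `y`-adic order `weightedOrder (Pi.single y 1)`.

* `inW w F` — the `w`-INITIAL FORM of a series (Perlega's `in_w(F)`; Mathlib's `weightedHomogeneousComponent` in the weighted order), `0` for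
  `F = 0`.  Its support is stub-7's `WildMonic.initSupp w F`.
* `flatPoly x y n W G` — the FLATTENING of a series to the one-variable polynomial `P(Y) = Σ_j [x^{W − n j} y^j]G · Y^j`: for a
  `w`-homogeneous `G` of weight `W` this is `G = x^W · P(y/xⁿ)`, Hauser–Perlega's `P♭` (their `flatInitial`, PointBlowupFlagTangentBound, is
  the polynomial-model analogue); `ord_{(y)} G = tdeg P`, `ord_{(x)} G = W − n·deg P`, `d(G) = ord G − ord_{(x)} G − ord_{(y)} G = deg P − tdeg P`,
  the Hasse derivative `∂_{y^k}` becomes `Polynomial.hasseDeriv k`, the twist becomes the Taylor shift `P(Y − t)` (theorems in the sibling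
  files, not here).
* `twist x y n t` — the substitution `x ↦ x`, `y ↦ y − t·xⁿ` (home coordinates of the flag with curve `y + t xⁿ = 0`): `subst (twist x y n t) F`
  is `F(x, y₁ − t xⁿ)`, i.e. `F` written in `(x, y₁)`.
* `initPts w N` — the `w`-INITIAL POINTS of a point set `N ⊂ ℕ²` (least `w`-weight); on the scaled Newton set of a tuple these are the Newton
  points of the weak initial ideal `minit_w(J₂)` (generated by the `in_w` of the generators of least weight, Perlega Ch. 2 §2 Remark);
  `dInit w N = δ − α − ε` of `initPts w N` — Perlega's boundary-free residual order `d(minit_w(J₂)) = ord − ord_{(x)} − ord_{(y)}` on the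
  `d!`-scale (`= d` of Prop. 6.2.3, `= d₁`/`d(minit_w(J₂′))` of Prop. 9.1.4 (4) / Prop. 6.2.4; the sibling `…WildMonicKangarooBlowup` bounds it
  after the monomial point step, with the set written out).
* `dStar y w B` — Perlega's `d_* = ord_{(y₁)} minit_w(J̃₂)` of a tuple `B` ALREADY WRITTEN IN THE SUBORDINATE COORDINATES `(x, y₁)` (so that
  `ord_{(y₁)}` is the `y`-adic order): the least `(d!/(d−j)) · ord_{(y)} in_w(B_j)` over the slots `j` attaining `m = wMin w B` — the second
  component of the lexicographic value `ỹ(J̃₂)`, `ỹ = (w, ord_{(y₁)} ∘ in_w)` (Lemma 2.2.1), on the generators; `⊤` for the zero tuple.  The raw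
  flag number `d_{𝓖,x₁}`; the conventions of Per17 §7.2 / HP p. 804 turning `(m, d_{𝓖,x₁})` into `d_𝓖` belong to the measure (D-0, (C5)).
WHY GENERATORS SUFFICE (remark, not used by the kernel): `w`, `ord`, `ord_{(x)}`, `ord_{(y)}` and `ỹ` are valuations of `k[[x,y]]`
(Perlega Ch. 2 §2 Remarks), so their values on `J₂ = coeff^d` and on `minit_w(J₂)` are attained on the generators `A_j^{d!/(d−j)}` resp. their
initial forms (`in_w` is multiplicative), whose exponents / forms are the `d!/(d−j)`-multiples of those of `A_j`.
-/

set_option linter.dupNamespace false -- mandated namespace of this single-conjunct summit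

noncomputable section

namespace Summit.ResolutionOfSingularities.ResolutionOfSingularities.Theorems

namespace WildMonic

open MvPowerSeries MonicDescent

variable {k : Type} [Field k]

/-! ## Initial forms, flattening, the twist -/

/-- The `w`-INITIAL FORM `in_w(F)` of a two-variable series: its weighted homogeneous component of weight `ord_w F` (`0` for `F = 0`). -/
def inW (w : Fin 2 → ℕ) (F : MvPowerSeries (Fin 2) k) : MvPowerSeries (Fin 2) k :=
  weightedHomogeneousComponent w (F.weightedOrder w).toNat F

/-- The FLATTENING `P(Y) = Σ_{j ≤ W/n} [x^{W − n j} y^j]G · Y^j` of a series `G` along the weight line `{a + n b = W}` of the letters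
`x` (weight `1`) and `y` (weight `n ≥ 1`): the one-variable polynomial with `G|_{weight W} = x^W · P(y / xⁿ)`. -/
def flatPoly (x y : Fin 2) (n W : ℕ) (G : MvPowerSeries (Fin 2) k) : Polynomial k :=
  ∑ j ∈ Finset.range (W / n + 1), Polynomial.monomial j (coeff (Finsupp.single x (W - n * j) + Finsupp.single y j) G)

/-- THE TWIST `x ↦ x`, `y ↦ y − t·xⁿ`: substituting it writes a series in the coordinates `(x, y₁)`, `y₁ = y + t·xⁿ`, subordinate to the flag
whose curve is `y + t·xⁿ = 0` (`subst (twist x y n t) F = F(x, y₁ − t xⁿ)`). -/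
def twist (x y : Fin 2) (n : ℕ) (t : k) : Fin 2 → MvPowerSeries (Fin 2) k :=
  fun i => if i = y then X y - C t * X x ^ n else X i

/-! ## The residual order of the initial points, and `d_*` -/

/-- The `w`-INITIAL POINTS of a point set: those of least `w`-weight (on a scaled Newton set: the Newton points of `minit_w(J₂)`). -/
def initPts (w : Fin 2 → ℕ) (N : Set (Fin 2 →₀ ℕ)) : Set (Fin 2 →₀ ℕ) :=
  {P | P ∈ N ∧ Finsupp.weight w P = sInf (Finsupp.weight w '' N)}

/-- The BOUNDARY-FREE RESIDUAL ORDER `d = δ − α − ε` of the `w`-initial points (Perlega's `d(minit_w(J₂)) = ord − ord_{(x)} − ord_{(y)}`,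
on the `d!`-scale). -/
def dInit (w : Fin 2 → ℕ) (N : Set (Fin 2 →₀ ℕ)) : ℕ :=
  deltaL (initPts w N) - alphaL (initPts w N) - epsL (initPts w N)

/-- PERLEGA'S `d_* = ord_{(y₁)} minit_w(J̃₂)` FOR A TUPLE WRITTEN IN THE SUBORDINATE COORDINATES `(x, y₁)`: the least
`(d!/(d−j)) · ord_{(y)} in_w(B_j)` over the slots `j` attaining `wMin w B` (`ord_{(y)}` = `weightedOrder (Pi.single y 1)`; `⊤` for the zero
tuple). -/
def dStar (y : Fin 2) (w : Fin 2 → ℕ) {d : ℕ} (B : Fin d → MvPowerSeries (Fin 2) k) : ℕ∞ :=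
  ⨅ j ∈ {j : Fin d | slotWOrd w B j = wMin w B}, (slotWeight d j : ℕ∞) * (inW w (B j)).weightedOrder (Pi.single y 1)

/-! ## Unfoldings -/

/-- Coefficients of the initial form. -/
theorem coeff_inW (w : Fin 2 → ℕ) (F : MvPowerSeries (Fin 2) k) (e : Fin 2 →₀ ℕ) :
    coeff e (inW w F) = if Finsupp.weight w e = (F.weightedOrder w).toNat then coeff e F else 0 :=
  coeff_weightedHomogeneousComponent w _ e F

/-- The initial form of `0` is `0`. -/
@[simp] theorem inW_zero (w : Fin 2 → ℕ) : inW w (0 : MvPowerSeries (Fin 2) k) = 0 := by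
  ext e; simp [coeff_inW]

/-- The initial form of a non-zero series is non-zero. -/
theorem inW_ne_zero (w : Fin 2 → ℕ) {F : MvPowerSeries (Fin 2) k} (hF : F ≠ 0) : inW w F ≠ 0 :=
  weightedHomogeneousComponent_of_weightedOrder (ENat.coe_toNat ((weightedOrder_eq_top_iff w).not.mpr hF))

/-- The initial form is weighted homogeneous of weight `(ord_w F).toNat`. -/
theorem isWeightedHomogeneous_inW (w : Fin 2 → ℕ) (F : MvPowerSeries (Fin 2) k) :
    IsWeightedHomogeneous w (inW w F) (F.weightedOrder w).toNat :=
  isWeightedHomogeneous_weightedHomogeneousComponent w F _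

/-- The support of the initial form is stub-7's `initSupp`. -/
theorem coeff_inW_ne_zero_iff (w : Fin 2 → ℕ) (F : MvPowerSeries (Fin 2) k) (e : Fin 2 →₀ ℕ) :
    coeff e (inW w F) ≠ 0 ↔ e ∈ initSupp w F := by
  rw [mem_initSupp_iff, coeff_inW]
  by_cases hF : F = 0
  · simp [hF]
  · have hfin : F.weightedOrder w ≠ ⊤ := (weightedOrder_eq_top_iff w).not.mpr hF
    constructor
    · intro h
      by_cases hw : Finsupp.weight w e = (F.weightedOrder w).toNat
      · rw [if_pos hw] at h
        exact ⟨h, by rw [hw, ENat.coe_toNat hfin]⟩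
      · rw [if_neg hw] at h; exact absurd rfl h
    · rintro ⟨hc, hw⟩
      rw [if_pos (by rw [← ENat.coe_inj, hw, ENat.coe_toNat hfin])]
      exact hc

/-- Coefficients of the flattening: `P_j = [x^{W − n j} y^j]G` for `j ≤ W / n`, `0` otherwise. -/
theorem coeff_flatPoly (x y : Fin 2) (n W : ℕ) (G : MvPowerSeries (Fin 2) k) (j : ℕ) :
    (flatPoly x y n W G).coeff j = if j ≤ W / n then coeff (Finsupp.single x (W - n * j) + Finsupp.single y j) G else 0 := by
  classical
  unfold flatPoly
  rw [Polynomial.finsetSum_coeff]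
  by_cases hj : j ≤ W / n
  · rw [if_pos hj, Finset.sum_eq_single j]
    · rw [Polynomial.coeff_monomial, if_pos rfl]
    · intro b _ hb
      rw [Polynomial.coeff_monomial, if_neg hb]
    · intro h
      exact absurd (Finset.mem_range.mpr (Nat.lt_succ_of_le hj)) h
  · rw [if_neg hj]
    refine Finset.sum_eq_zero fun b hb => ?_
    rw [Polynomial.coeff_monomial, if_neg]
    rintro rfl
    exact hj (Nat.le_of_lt_succ (Finset.mem_range.mp hb))

/-- For `n ≥ 1` the index condition `j ≤ W / n` is `n j ≤ W`. -/
theorem le_div_iff_mul_le' {n W j : ℕ} (hn : 1 ≤ n) : j ≤ W / n ↔ n * j ≤ W := by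
  rw [Nat.le_div_iff_mul_le hn, mul_comm]

/-- Components of the twist. -/
@[simp] theorem twist_apply_self (x y : Fin 2) (n : ℕ) (t : k) : twist x y n t y = X y - C t * X x ^ n := by
  simp [twist]

/-- Components of the twist. -/
theorem twist_apply_of_ne (x y : Fin 2) (n : ℕ) (t : k) {i : Fin 2} (hi : i ≠ y) : twist x y n t i = X i := by
  simp [twist, hi]

/-- The twist is substitutable (`n ≥ 1`: every component has zero constant coefficient). -/
theorem hasSubst_twist (x y : Fin 2) {n : ℕ} (hn : 1 ≤ n) (t : k) : HasSubst (twist x y n t) := by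
  refine hasSubst_of_constantCoeff_zero fun i => ?_
  by_cases hi : i = y
  · subst hi
    simp [twist_apply_self, constantCoeff_X, zero_pow (Nat.pos_iff_ne_zero.mp hn)]
  · simp [twist_apply_of_ne x y n t hi, constantCoeff_X]

/-- Membership in the initial points. -/
theorem mem_initPts_iff (w : Fin 2 → ℕ) (N : Set (Fin 2 →₀ ℕ)) (P : Fin 2 →₀ ℕ) :
    P ∈ initPts w N ↔ P ∈ N ∧ Finsupp.weight w P = sInf (Finsupp.weight w '' N) := Iff.rfl

/-- The initial points form a subset. -/
theorem initPts_subset (w : Fin 2 → ℕ) (N : Set (Fin 2 →₀ ℕ)) : initPts w N ⊆ N := fun _ hP => hP.1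

/-- The initial points of a nonempty set are nonempty (the least weight is attained). -/
theorem initPts_nonempty (w : Fin 2 → ℕ) {N : Set (Fin 2 →₀ ℕ)} (hN : N.Nonempty) : (initPts w N).Nonempty := by
  obtain ⟨P, hP, hPw⟩ := Nat.sInf_mem (hN.image (Finsupp.weight w))
  exact ⟨P, hP, hPw⟩

/-- Unfolding of `dInit`. -/
theorem dInit_eq (w : Fin 2 → ℕ) (N : Set (Fin 2 →₀ ℕ)) :
    dInit w N = deltaL (initPts w N) - alphaL (initPts w N) - epsL (initPts w N) := rfl

/-- `dStar` is below the value of every attaining slot. -/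
theorem dStar_le (y : Fin 2) (w : Fin 2 → ℕ) {d : ℕ} (B : Fin d → MvPowerSeries (Fin 2) k) {j : Fin d}
    (hj : slotWOrd w B j = wMin w B) :
    dStar y w B ≤ (slotWeight d j : ℕ∞) * (inW w (B j)).weightedOrder (Pi.single y 1) :=
  iInf₂_le j hj

/-- A common lower bound of the attaining slots bounds `dStar` from below. -/
theorem le_dStar (y : Fin 2) (w : Fin 2 → ℕ) {d : ℕ} (B : Fin d → MvPowerSeries (Fin 2) k) {c : ℕ∞}
    (h : ∀ j : Fin d, slotWOrd w B j = wMin w B → c ≤ (slotWeight d j : ℕ∞) * (inW w (B j)).weightedOrder (Pi.single y 1)) :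
    c ≤ dStar y w B :=
  le_iInf₂ h

end WildMonic

end Summit.ResolutionOfSingularities.ResolutionOfSingularities.Theorems

end
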